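import Summits.QuantumFields.QCD.Theorems.NestedDissectionSeaEarlyCrosserLawStubDiracKato
import Summits.QuantumFields.QCD.Theorems.NestedDissectionSeaEarlyCrosserLawStubWeitzenbockDivergence
import Summits.QuantumFields.QCD.Theorems.NestedDissectionSeaEarlyCrosserLawStubKatoSobolevCutoff
import Summits.QuantumFields.QCD.Theorems.NestedDissectionSeaEarlyCrosserLawStubSobolevFourR4
import Summits.QuantumFields.QCD.Theorems.NestedDissectionSeaEarlyCrosserLawStubFloorAssembly
import HarnessLib

/-!
# The zero-mode action floor on flat `ℝ⁴` (unconditional)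
(line `zero-mode-floor-dilute-gas` of crux `Summit.QuantumFields.QCD.Theses.NestedDissectionSea.EarlyCrosserLaw`,
item stmt-QuantumFields-13995; lead c7)

The composed analytic half of the line, now a theorem with no hypothesis: **there is `κ > 4/9` (in fact `κ = 1/2`,
and the proof gives `S ≥ 50π²/9`) such that every smooth connection `A` on `ℝ⁴` with pointwise anti-Hermitian
traceless values in `M₃(ℂ)`, finite coordinate-frame Yang–Mills action `S = ∫ ymDensityOfBasis (basisFun) A`
(the BPST instanton has `S = 8π²` in this normalisation), integrable topological density of zero total charge, and a
smooth, square-integrable, somewhere non-zero solution `ψ` of the twisted Dirac equation `Σ_μ γ_μ(∂_μ + A_μ)ψ = 0`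
satisfies `κ · 8π² ≤ S`.**  This is the statement `stub_zeroModeActionFloor` of the strategist's skeleton v2 (the
hypothesis of the dilute-gas stub S3), obtained as `stub_floorAssembly stub_weitzenbockDivergence
(stub_katoSobolevCutoff stub_sobolevFourR4 stub_diracKato)` from the five landed stubs: sharp `L⁴` Sobolev on `ℝ⁴`
(S2a, from `Literature.Geometry.Riemannian.sharp_sobolev_euclidean_four`), Dirac–Kato `4/5` (S2b), the Weitzenböck
divergence identity (S2e), the cut-off Kato–Sobolev bound (S2f) and the assembly (S2g).  It settles, on the true
side and with margin `0.69 > 4/9`, the sharp target §5.5 of the crux's standing disproof file.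
-/

noncomputable section

open scoped BigOperators Matrix Matrix.Norms.Frobenius
open MeasureTheory Literature.MathematicalPhysics.QuantumLattice

namespace Summit.QuantumFields.QCD.Cruxes.EarlyCrosserLaw.ZeroModeFloorDiluteGas

/-- **The zero-mode action floor** (`κ₀(SU(3), Q = 0) > 4/9` on flat `ℝ⁴`; unconditional).  See the module docstring. -/
theorem zeroModeActionFloor :
    ∃ κ : ℝ, 4 / 9 < κ ∧ ∀ (A : Connection (EuclideanSpace ℝ (Fin 4)) (Matrix (Fin 3) (Fin 3) ℂ)) (ψ : EuclideanSpace ℝ (Fin 4) → Fin 4 → Fin 3 → ℂ), IsSmoothConnection A → (∀ x v, (A x v)ᴴ = -(A x v) ∧ (A x v).trace = 0) → Integrable (ymDensityOfBasis (EuclideanSpace.basisFun (Fin 4) ℝ) A) → Integrable (fun x => (((curvature A x (EuclideanSpace.single (0 : Fin 4) (1 : ℝ)) (EuclideanSpace.single (1 : Fin 4) (1 : ℝ))) * (curvature A x (EuclideanSpace.single (2 : Fin 4) (1 : ℝ)) (EuclideanSpace.single (3 : Fin 4) (1 : ℝ)))).trace - ((curvature A x (EuclideanSpace.single (0 : Fin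 4) (1 : ℝ)) (EuclideanSpace.single (2 : Fin 4) (1 : ℝ))) * (curvature A x (EuclideanSpace.single (1 : Fin 4) (1 : ℝ)) (EuclideanSpace.single (3 : Fin 4) (1 : ℝ)))).trace + ((curvature A x (EuclideanSpace.single (0 : Fin 4) (1 : ℝ)) (EuclideanSpace.single (3 : Fin 4) (1 : ℝ))) * (curvature A x (EuclideanSpace.single (1 : Fin 4) (1 : ℝ)) (EuclideanSpace.single (2 : Fin 4) (1 : ℝ)))).trace).re) → ∫ x, (fun x => (((curvature A x (EuclideanSpace.single (0 : Fin 4) (1 : ℝ)) (EuclideanSpace.single (1 : Fin 4) (1 : ℝ))) * (curvature A x (EuclideanSpace.single (2 : Fin 4) (1 : ℝ)) (EuclideanSpace.single (3 : Fin 4) (1 : ℝ)))).trace - ((curvature A x (EuclideanSpace.single (0 : Fin 4) (1 : ℝ)) (EuclideanSpace.single (2 : Fin 4) (1 : ℝ))) * (curvature A x (EuclideanSpace.single (1 : Fin 4) (1 : ℝ)) (EuclideanSpace.single (3 : Fin 4) (1 : ℝ)))).trace + ((curvature A x (EuclideanSpace.single (0 : Fin 4) (1 : ℝ)) (EuclideanSpace.single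 (3 : Fin 4) (1 : ℝ))) * (curvature A x (EuclideanSpace.single (1 : Fin 4) (1 : ℝ)) (EuclideanSpace.single (2 : Fin 4) (1 : ℝ)))).trace).re) x = 0 → ContDiff ℝ ((⊤ : ℕ∞) : WithTop ℕ∞) ψ → Integrable (fun x => ∑ s, ∑ c, ‖ψ x s c‖ ^ 2) → (∃ x, ψ x ≠ 0) → (∀ x s c, ∑ μ : Fin 4, ∑ s' : Fin 4, euclideanGamma μ s s' * (fderiv ℝ (fun y => ψ y s' c) x (EuclideanSpace.single μ (1 : ℝ)) + ∑ c' : Fin 3, A x (EuclideanSpace.single μ (1 : ℝ)) c c' * ψ x s' c') = 0) → κ * (8 * Real.pi ^ 2) ≤ ∫ x, ymDensityOfBasis (EuclideanSpace.basisFun (Fin 4) ℝ) A x :=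
  stub_floorAssembly stub_weitzenbockDivergence (stub_katoSobolevCutoff stub_sobolevFourR4 stub_diracKato)

end Summit.QuantumFields.QCD.Cruxes.EarlyCrosserLaw.ZeroModeFloorDiluteGas

end
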